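import Literature.AnabelianGeometry.EtaleTheta.Discharge.Sec2Cor28iiiEndKnitChiCusp
import Literature.AnabelianGeometry.EtaleTheta.Discharge.Sec2OrbitEmbeddingStandard
import HarnessLib

/-!
# [EtTh] Cor 2.8 (i) at the cusped inversion model `χ′`, I: the standing hypothesis «`η̈^{Θ,ℤ×μ₂}` is of standard type»
# (Def 2.7, abc-iut-L2-t2's `ThetaOrbitData.IsStandard`) is a THEOREM at the SECTION-route cover of record (proof-only)

S. Mochizuki, *The étale theta function and its Frobenioid-theoretic manifestations* [EtTh], Publ. RIMS **45** (2009), §2,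
Cor 2.8 (i) PRIMS PDF p.42 («`γ` preserves the property that `η̈^{Θ,ℤ×μ₂}` … be of standard type»), Def 2.7 p.41 («if `η̈^{Θ,ℤ}` is
of standard type [Def 1.9 (ii)] then we shall also refer to … `η̈^{Θ,ℤ×μ₂}` as being of standard type»), Def 1.9 p.29 (`τ^{±1}`,
`Ü(τ) = √−1`), Prop 1.3 p.20 (the étale theta class), Prop 1.4 (iii) p.22 (bib key `MochizukiEtTh2009`).

PROOF-ONLY companion (0 `def`, 0 `instance`, no new `Prop`; cell abc-iut, layer L2, seat abc-iut-f-151 gen 7 — block-F tranche 151's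
row F-0640 `Cor28_i`; abc-iut-L2-lead R1055/R1119 «EtTh:Cor2.8(i) NOT YET — residual = hstd at a cover of record», VNEXT note
N-C28I-1 of abc-iut-w6-d049; every input BY NAME, nothing restated).  abc-iut-L2-t2's typed `ThetaOrbitData.Cor28_i`
(`ThetaRootOrbits`) opens with the standing hypothesis `O.IsStandard` (Def 2.7: SOME class of `η̈^{Θ,ℤ×μ₂}` restricts, on SOME
decomposition group `D ∈ Dtau` over `τ^{±1}`, to a `2`-torsion class).  At the χ′ cover of record the only producer so far was
abc-iut-w5-d118's `ofEmbedding_isStandard_of_isOfStandardType` (p446504) from FACT-LIST F-0573 — the live binder of the K4 row.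
THIS FILE proves `IsStandard` DIRECTLY at the model, for the model's OWN theta class `η̈^Θ = etaDdχ` (abc-iut-L2-d1) and the
ANCHORED Def. 1.9 pair `τ := tauχ′`, `τ⁻¹ := tauInvχ′` of abc-iut-w5-d118 (`D_{τ^{±1}} = s_{(√−1)^{±1}}(G_K̈)`, `Ü(τ^{±1}) = (√−1)^{±1}`):
* §1 `centreRep_bPowGfp`, `thetaCocycleFunχ_eq_one_of_left_eq_bPowGfp`, `thetaCocycleFunχ_sectionOfUnitχ` — abc-iut-L2-d1's theta
  cocycle `θ(γ·σ) = toTheta(γ·b^{−ŷ(γ)})` VANISHES on every element of `Π^tp_Y` whose `Γ`-part is a pure `b`-power, in particular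
  on abc-iut-L2-t6's `κ_u²`-twisted sections `s_u(σ) = ⟨b^{2κ_u(σ)}, σ⟩` — the decomposition groups of the anchored points of `Ÿ(K̈)`;
* §2 **`isStandard_ofEmbedding_orbitEmbeddingOfHuuOfSection_of_Dpt_le_sectionOfUnitχ`** — `IsStandard` for
  `ofEmbedding (orbitEmbeddingOfHuuOfSection …)` over `MuTwoSetting.inversionModelχ′` (abc-iut-w5-d140), ANY `CLevelData`,
  completion, section, `g`, choice `X̲̲`, whenever `E.etaDd = etaDdχ` and the slot `τ` has `D_τ ≤ s_u(G_K̈)`: abc-iut-L2-t2's §1-level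
  criterion `ofEmbedding_isStandard_of` (p427195) with the orbit member `σ = 1`, the representative theta cocycle and `d₀ = 1`
  (the restriction to `D_τ` is TRIVIAL, a fortiori `2`-torsion) — no F-0573, no `StandardData`, no `evalAt`;
* §3 **`isStandard_coverOfRecordχ'_tauχ'`** — RESIDUAL ∅ at THE cover of record (completion `toPiCHat`, section `sectionχ′`,
  `g := ε_±`, abc-iut-L2-t10's `doubleUnderlineχ'Sec`, `τ^{±1} := tauχ′/tauInvχ′`; `p ≡ 1 (mod 4)`, every odd `l`, every
  once-punctured datum `eX`) and **`isStandard_coverOfRecordχ'_anchoredPointχ'OfUnit`** — the same for EVERY prime `p` with both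
  Def-1.9 slots filled by the anchored point `Ü = 1 + p` (HONEST LABEL: a slot filling, not the Def. 1.9 pair, which needs
  `√−1 ∈ K`, i.e. `p ≡ 1 (mod 4)`; `IsStandard` reads only the decomposition group of the slot).
The sequel `Discharge/Sec2Cor28iEndKnitChiCusp` (this seat) feeds `IsStandard` into the body of `Cor28_i` for every inner `γ`.
HONEST FRAMING: semi-synthetic model (χ-twisted root with a synthetic cusp; the theta class OF THE MODEL; its value `1` at the
anchored `τ` is not the printed `Θ̈(√−1)`) = consistency / non-vacuity evidence for the TYPED interface only; [EtTh] is refereed and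
nothing of it is asserted; no side is taken on [IUTchIII] Cor 3.12; typed ≠ proved; instantiated ≠ endorsed.
-/

noncomputable section

namespace Literature.AnabelianGeometry.EtaleTheta

open Literature.AnabelianGeometry.SemiGraphs ThetaCovers Literature.IUT.HodgeArakelov
open _root_.Topology _root_.Function
open ThetaSetting.EtaleThetaData.DoubleUnderline.OrbitEmbedding (symm_toTheta_eq)

namespace SettingModel

variable (p : ℕ) [Fact p.Prime]

/-! ## §1. The model's theta cocycle VANISHES on the `b`-axis sections `s_u(G_K̈)` (and on `inr(G_K̈)`) -/

/-- `γ · b^{−ŷ(γ)} = 1` for `γ = b^t`: the centre component of a pure `b`-power is trivial.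
[cite: MochizukiEtTh2009, Prop 1.3 p.20] -/
theorem centreRep_bPowGfp (t : ZH) : centreRep (bPowGfp t) = 1 := by
  unfold centreRep
  rw [gfpFst_bPowGfp, eHatB_bPow, mul_inv_cancel]

/-- **The theta cocycle of the χ-model vanishes on every element of `Π^tp_Y` whose `Γ`-part is a pure `b`-power**
(`θ(γ·σ) = toTheta(γ·b^{−ŷ(γ)})`). [cite: MochizukiEtTh2009, Prop 1.3 p.20] -/
theorem thetaCocycleFunχ_eq_one_of_left_eq_bPowGfp (g : ↥(ThetaSetting.modelχ p).GtpY) (t : ZH)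
    (hg : (g : PiTpχ p).left = bPowGfp t) : thetaCocycleFunχ p g = 1 := by
  apply Subtype.ext
  rw [coe_thetaCocycleFunχ, hg, centreRep_bPowGfp, map_one, map_one, OneMemClass.coe_one]

/-- In particular **on the `κ_u²`-twisted section `s_u(σ) = ⟨b^{2κ_u(σ)}, σ⟩`** — the decomposition group of the ANCHORED
point of `Ÿ(K̈)` with `Ü = u` (abc-iut-L2-t6's `sectionOfUnitχ`): `θ(s_u(σ)) = 1`. [cite: MochizukiEtTh2009, Prop 1.4 (iii) p.22] -/
theorem thetaCocycleFunχ_sectionOfUnitχ (u : (↥(ThetaSetting.modelχ p).Kdd)ˣ) (σ : GQp p)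
    (h : sectionOfUnitχ p u σ ∈ (ThetaSetting.modelχ p).GtpY) :
    thetaCocycleFunχ p ⟨sectionOfUnitχ p u σ, h⟩ = 1 :=
  thetaCocycleFunχ_eq_one_of_left_eq_bPowGfp p _ (kappaUnitχ p u σ * kappaUnitχ p u σ) rfl

/-! ## §2. `IsStandard` (Def 2.7) HOLDS at the section-route cover whenever a Def-1.9 slot sits on a `b`-section -/

section HStd

variable {PC : Type} [Group PC] [TopologicalSpace PC] [IsTopologicalGroup PC] [T2Space PC]
variable (e : (MuTwoSetting.inversionModelχ' p).CLevelData)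
  (ιC : (MuTwoSetting.inversionModelχ' p).GtpC →ₜ* PC) (hιC : IsProfiniteCompletion ιC)
  (hinj : Function.Injective ιC) (op : (MuTwoSetting.inversionModelχ' p).toThetaSetting.OncePuncturedData)
  {l : ℕ+} (hodd : Odd ((l : ℕ+) : ℕ))
  (s : ↥(MuTwoSetting.inversionModelχ' p).GK →* (MuTwoSetting.inversionModelχ' p).PiTemp)
  (hsa : ∀ σ, (MuTwoSetting.inversionModelχ' p).aug (s σ) = (σ : GQp p))
  (hsZ : ∀ σ, (MuTwoSetting.inversionModelχ' p).toZ (s σ) = 1)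
  (hιell : ∀ c ∈ (e.piCDataOf ιC hιC).augGK.ker, c ∉ (e.piCDataOf ιC hιC).PiX →
    ∀ d ∈ (e.piCDataOf ιC hιC).PiX ⊓ (e.piCDataOf ιC hιC).augGK.ker,
      c * d * c⁻¹ * d ∈ (e.piCDataOf ιC hιC).barTheta l)
  (hN : (((MuTwoSetting.inversionModelχ' p).GtpXu l).map (MuTwoSetting.inversionModelχ' p).inclX).Normal)
  (hY : ((MuTwoSetting.inversionModelχ' p).GtpY.map (MuTwoSetting.inversionModelχ' p).inclX).Normal)
  {E : (MuTwoSetting.inversionModelχ' p).toThetaSetting.EtaleThetaData} (hE : E.etaDd = etaDdχ p)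
  (C : E.DoubleUnderline (l : ℕ))
  (hK : (MuTwoSetting.inversionModelχ' p).barKerTp l ≤ C.Huu) (hsH : ∀ σ, s σ ∈ C.Huu)
  (τ τ' : ThetaSetting.NonCuspidalPoint E.toKummerData)

include hE

/-- **`IsStandard` (abc-iut-L2-t2's Def 2.7 predicate) HOLDS at `ofEmbedding (orbitEmbeddingOfHuuOfSection …)` over `χ′`**
for every `CLevelData`, completion, section and choice `X̲̲`, as soon as the class is the model's theta class `etaDdχ` and the
Def-1.9 slot `τ` has its decomposition group on a `b`-axis section, `D_τ ≤ s_u(G_K̈)` for some unit `u` — the case of the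
ANCHORED points `anchoredPointχ′OfUnit u` (`Ü = u`), in particular of the Def. 1.9 pair `tauχ′`/`tauInvχ′` (`u = (√−1)^{±1}`):
the representative theta cocycle of `η̈^Θ` itself (orbit member `σ = 1`) VANISHES on `D_τ` (§1), so its restriction is
`2`-torsion (indeed trivial) there — abc-iut-L2-t2's criterion `ofEmbedding_isStandard_of` with `d₀ = 1`.
[cite: MochizukiEtTh2009, Def 2.7 p.41] -/
theorem isStandard_ofEmbedding_orbitEmbeddingOfHuuOfSection_of_Dpt_le_sectionOfUnitχ
    (hq : (MuTwoSetting.inversionModelχ' p).toThetaSetting.Compat) (hS : (MuTwoSetting.inversionModelχ' p).toThetaSetting.Sec2Hyps)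
    {g : (MuTwoSetting.inversionModelχ' p).GtpC} (hgX : g ∉ (MuTwoSetting.inversionModelχ' p).inclX.range)
    (hι' : C.IotaStable (e.conjX g))
    (u : (↥(ThetaSetting.modelχ p).Kdd)ˣ)
    (hτ : τ.Dpt ≤ (ThetaSetting.modelχ p).GKdd.map (sectionOfUnitχ p u)) :
    (ThetaOrbitData.ofEmbedding
      (e.orbitEmbeddingOfHuuOfSection ιC hιC hinj op hodd s hsa hsZ hιell hN hY C hK hsH hgX hι' τ τ') hq hS).IsStandard := by
  haveI := hq.GtpYdd_normal
  refine ThetaOrbitData.ofEmbedding_isStandard_of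
    (e.orbitEmbeddingOfHuuOfSection ιC hιC hinj op hodd s hsa hsZ hιell hN hY C hK hsH hgX hι' τ τ') hq hS 1
    (ContH1.resCocycle (ThetaSetting.modelχ p).toTheta (ThetaSetting.modelχ p).DeltaTheta
      (ThetaSetting.modelχ p).GtpYdd_le_GtpY (thetaCocycleχ p)) ?_ τ (Or.inl rfl) 1 ?_
  · rw [ContH1.conj_one_apply, hE, etaDdχ_eq_mk]
    rfl
  · intro g hg
    obtain ⟨σ, -, hσ⟩ := Subgroup.mem_map.1 (hτ (Subgroup.mem_inf.1 hg).1)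
    -- the representative is the theta cocycle, which vanishes at `g = s_u(σ)` (§1)
    have key : ∀ (x : ↥(ThetaSetting.modelχ p).GtpYdd), ((x : PiTpχ p)) = sectionOfUnitχ p u σ →
        (ContH1.resCocycle (ThetaSetting.modelχ p).toTheta (ThetaSetting.modelχ p).DeltaTheta
          (ThetaSetting.modelχ p).GtpYdd_le_GtpY (thetaCocycleχ p)).1 x = 1 := fun x hx =>
      thetaCocycleFunχ_eq_one_of_left_eq_bPowGfp p _ (kappaUnitχ p u σ * kappaUnitχ p u σ)
        (by change (x : PiTpχ p).left = _; rw [hx]; rfl)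
    rw [map_one, one_mul, inv_one]
    exact (congrArg (· ^ 2) (key _ hσ.symm)).trans (one_pow 2)

end HStd

/-! ## §3. RESIDUAL ∅ at THE cover of record: the Def. 1.9 pair `τ^{±1}` (`p ≡ 1 (mod 4)`); every `p` at an anchored slot -/

/-- **`IsStandard` HOLDS at THE cover of record over `inversionModelχ′` with the Def. 1.9 pair `τ := tauχ′`, `τ′ := tauInvχ′`**
(`p ≡ 1 (mod 4)`, every odd `l`, every once-punctured datum `eX` — an inhabited type, `nonempty_oncePuncturedData_modelχ'`): the
section-route cover over THE completion `toPiCHat` with the Galois section `sectionχ′`, `g := ε_±`, abc-iut-L2-t10's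
`doubleUnderlineχ'Sec` (`Π^tp_{X̲̲} = Huuχ p l`, class `η̈^Θ = etaDdχ`).  `D_τ = s_{√−1}(G_K̈)` is a `b`-axis section, so §2 applies.
Cor 2.8 (i)'s standing hypothesis is thereby NON-VACUOUS at this cover. [cite: MochizukiEtTh2009, Def 2.7 p.41] -/
theorem isStandard_coverOfRecordχ'_tauχ' (hp : p % 4 = 1) (l : ℕ+) (hodd : Odd ((l : ℕ+) : ℕ))
    (eX : (MuTwoSetting.inversionModelχ' p).toThetaSetting.OncePuncturedData) :
    (ThetaOrbitData.ofEmbedding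
      ((cLevelDataInvχ' p).orbitEmbeddingOfHuuOfSection (cLevelDataInvχ' p).toPiCHat
        (cLevelDataInvχ' p).isProfiniteCompletion_toPiCHat (cLevelDataInvχ' p).toPiCHat_injective eX hodd (sectionχ' p)
        (aug_sectionχ' p) (toZ_sectionχ' p) (inv_ell_piCData_inversionModelχ' p l eX)
        ((cLevelDataInvχ' p).map_inclX_GtpXu_normal l (kerToZIsCompactlyGenerated_modelχ' p))
        ((cLevelDataInvχ' p).map_inclX_GtpY_normal (kerToZIsCompactlyGenerated_modelχ' p)) (doubleUnderlineχ'Sec p l hodd)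
        (barKerTp_le_Huuχ_inversionModelχ' p l hodd) (fun σ => inr_mem_Huuχ p l σ) (epsPMInvχ_not_mem_range p)
        (iotaStable_conjX_epsPMInvχ' p (doubleUnderlineχ'Sec p l hodd) rfl)
        (tauχ' p hp).toNonCuspidalPoint (tauInvχ' p hp).toNonCuspidalPoint)
      (MuTwoSetting.inversionModelχ'_compat p) (ThetaSetting.modelχ'_sec2Hyps p)).IsStandard :=
  isStandard_ofEmbedding_orbitEmbeddingOfHuuOfSection_of_Dpt_le_sectionOfUnitχ p (cLevelDataInvχ' p) _ _ _ eX hodd _ _ _ _ _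
    _ rfl (doubleUnderlineχ'Sec p l hodd) _ _ _ _ _ _ _ _ (sqrtNegOneUnitχ p hp) (Dpt_tauχ' p hp).le


/-- **`IsStandard` at THE cover of record for EVERY prime `p`**, both Def-1.9 slots filled by abc-iut-w5-d118's anchored point
`anchoredPointχ′OfUnit (1+p)` (`D = s_{1+p}(G_K̈)`, `Ü = 1 + p`): a `b`-axis section again, so §2 applies (HONEST LABEL: a slot
filling — the Def. 1.9 pair itself needs `√−1 ∈ K`, i.e. `p ≡ 1 (mod 4)`; `IsStandard` reads only the slot's decomposition group).
[cite: MochizukiEtTh2009, Def 2.7 p.41] -/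
theorem isStandard_coverOfRecordχ'_anchoredPointχ'OfUnit (l : ℕ+) (hodd : Odd ((l : ℕ+) : ℕ))
    (eX : (MuTwoSetting.inversionModelχ' p).toThetaSetting.OncePuncturedData) :
    (ThetaOrbitData.ofEmbedding
      ((cLevelDataInvχ' p).orbitEmbeddingOfHuuOfSection (cLevelDataInvχ' p).toPiCHat
        (cLevelDataInvχ' p).isProfiniteCompletion_toPiCHat (cLevelDataInvχ' p).toPiCHat_injective eX hodd (sectionχ' p)
        (aug_sectionχ' p) (toZ_sectionχ' p) (inv_ell_piCData_inversionModelχ' p l eX)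
        ((cLevelDataInvχ' p).map_inclX_GtpXu_normal l (kerToZIsCompactlyGenerated_modelχ' p))
        ((cLevelDataInvχ' p).map_inclX_GtpY_normal (kerToZIsCompactlyGenerated_modelχ' p)) (doubleUnderlineχ'Sec p l hodd)
        (barKerTp_le_Huuχ_inversionModelχ' p l hodd) (fun σ => inr_mem_Huuχ p l σ) (epsPMInvχ_not_mem_range p)
        (iotaStable_conjX_epsPMInvχ' p (doubleUnderlineχ'Sec p l hodd) rfl)
        (anchoredPointχ'OfUnit p (onePlusP p) (onePlusP_ne_cusp p)).toNonCuspidalPoint 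
        (anchoredPointχ'OfUnit p (onePlusP p) (onePlusP_ne_cusp p)).toNonCuspidalPoint)
      (MuTwoSetting.inversionModelχ'_compat p) (ThetaSetting.modelχ'_sec2Hyps p)).IsStandard :=
  isStandard_ofEmbedding_orbitEmbeddingOfHuuOfSection_of_Dpt_le_sectionOfUnitχ p (cLevelDataInvχ' p) _ _ _ eX hodd _ _ _ _ _
    _ rfl (doubleUnderlineχ'Sec p l hodd) _ _ _ _ _ _ _ _ (onePlusP p) (Dpt_anchoredPointχ'OfUnit p _ _).le

end SettingModel

end Literature.AnabelianGeometry.EtaleTheta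

end
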